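import Summits.AtomisticToContinuum.Crystallization.Theorems.FreeSplittingCertificatesStrictSplittingRuleP1CellMomentsReal
import Summits.AtomisticToContinuum.Crystallization.Theorems.FreeSplittingCertificatesStrictSplittingRuleP1VertexRegroup

/-!
# `StrictSplittingRule` (stmt-AtomisticToContinuum-12560): the FIRST MOMENT of a hat function of the quarter triangulation — the vertex star is NOT centrosymmetric (P1 interpolant object, part 25)

Route `FreeSplittingCertificates`, crux r3 `StrictSplittingRule` (H12⋆ = `stub_coreJointCoercive`), unit b2b-freesplit-B gen 27.
VALUE = the kernel form of FINDING 1 of HOME CERT.md §28 (the number behind certificate F2 and the per-site domination rule of the matched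
split): for every site `q` of the hcp lattice, the hat function `φ_q = Σ_{cells T ∋ q} λ_q^T` of the tree's P1 chart (part 3: every octahedron cut
into four quarters along ONE diagonal) has first moment
  `∫ φ_q(y)(y − y_q) dy = Σ_{T ∋ q} (|T|/20)·Σ_{m'}(y_{m'}^T − y_q) = (√3a²h/240)·W(q)`,  **`W(q) = ±(10a, −(10√3/3)a, 0)`** (`+` on even layers),
i.e. `m₁ = W/120 = ±(a/12)(1, −1/√3, 0) ≠ 0`, `|m₁| = a/(6√3)` (in-plane, alternating with the layer parity): the 24-cell vertex star of the
quarter triangulation is not centrosymmetric, so hat-averages of radial weights carry FIRST-order terms `∓0.77(a/r)cos θ` — the reason the far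
side of the matched split must over-cover the radial deficit beyond the near reach (certificate F2, `(7D+C)/8 = 19/16`).  Stated in the
incidence form of `tsum_cellVertex_eq_tsum_site` (part 26): the cells of the star of `q` are the `(q − o, π)` with `p1VertOff (p1Par (q−o)) π m = o`.
* `setIntegral_p1Lam_star_incidence` — one incidence, via `setIntegral_p1Lam_mul_coord_sub` (part 24);
* `p1Star_sum_offsets` (the incidence/edge multiset of the star: the 12 nearest neighbours with multiplicities 4/6, two octahedron
  diagonals, 24 zero offsets — pure table computation), `p1StarSum_hcpSite`, `p1Star_edgeSum` — the lattice identity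
  `Σ_{incidences} Σ_{m'} (y_{m'} − y_q) = W(q)`; `p1Hat_firstMoment_ne_zero`;
* **`p1Hat_firstMoment`** — the star first moment.
NOT a proof of H12⋆, NOT summit progress.  [folklore: P1 finite elements]
-/

noncomputable section

open Set Function Metric MeasureTheory Filter Topology
open scoped BigOperators NNReal ENNReal

namespace Summit.AtomisticToContinuum.Crystallization.Theorems.StrictSplittingRuleBirth

open Summit.AtomisticToContinuum.Crystallization.Theorems.PalmUnimodularRigidity.LayeredLawsSelectHcp
  (hcpSite hcpSite_apply_zero hcpSite_apply_one hcpSite_apply_two)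
open Literature.MathematicalPhysics.StatisticalMechanics (haggLabel alternatingHagg haggLabel_alternating)

/-- **One incidence of the star**: if vertex `m` of the cell `(q − o, π)` is the site `q` (`p1VertOff (p1Par (q−o)) π m = o`), then
`∫_{cell} λ_m(y)(y_k − (y_q)_k) dy = (√3a²h/240)·Σ_{m'}((y_{m'})_k − (y_q)_k)`. -/
theorem setIntegral_p1Lam_star_incidence {a h : ℝ} (ha : 0 < a) (hh : 0 < h) (q o : ℤ × ℤ × ℤ) (π : Fin 6) (m : Fin 4) (k : Fin 3)
    (ho : p1VertOff (p1Par (q - o)) π m = o) :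
    ∫ y in p1RealCell a h (q - o, π), p1Lam a h (q - o, π) m y * (y k - hcpSite a h q k) =
      √3 * a ^ 2 * h / 240 * ∑ m' : Fin 4, (hcpSite a h ((q - o) + p1VertOff (p1Par (q - o)) π m') k - hcpSite a h q k) := by
  have hq : (q - o) + p1VertOff (p1Par (q - o)) π m = q := by rw [ho]; abel
  have := setIntegral_p1Lam_mul_coord_sub ha hh (q - o, π) m k
  simp only [hq] at this
  exact this

/-- **The incidence structure of the star** (pure table computation): for any `G` on offsets, the incidence sum of `G(v_{m'} − o)` over the
24 cells `(q − o, π)` cornering at `q` with `q` as vertex `m` is `p1StarSumEven G` / `p1StarSumOdd G` according to the layer parity of `q`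
(72 edges: the 12 nearest neighbours with multiplicities 4 or 6 and two octahedron diagonals, + 24 zero offsets). -/
theorem p1Star_sum_offsets (q : ℤ × ℤ × ℤ) (G : ℤ × ℤ × ℤ → ℝ) :
    (∑ o ∈ p1Corners, ∑ π : Fin 6, ∑ m : Fin 4,
        if p1VertOff (p1Par (q - o)) π m = o then ∑ m' : Fin 4, G (p1VertOff (p1Par (q - o)) π m' - o) else 0) =
      if Even q.1 then
        (4 * G (-1, -1, 0) + 6 * G (-1, 0, -1) + 6 * G (-1, 0, 0) + 4 * G (-1, 1, -1) + 6 * G (0, -1, 0) + 6 * G (0, -1, 1) +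
          4 * G (0, 0, -1) + 24 * G (0, 0, 0) + 4 * G (0, 0, 1) + 6 * G (0, 1, -1) + 6 * G (0, 1, 0) + 4 * G (1, -1, 0) +
          6 * G (1, 0, -1) + 6 * G (1, 0, 0) + 4 * G (1, 1, -1))
      else
        (4 * G (-1, -1, 1) + 6 * G (-1, 0, 0) + 6 * G (-1, 0, 1) + 4 * G (-1, 1, 0) + 6 * G (0, -1, 0) + 6 * G (0, -1, 1) +
          4 * G (0, 0, -1) + 24 * G (0, 0, 0) + 4 * G (0, 0, 1) + 6 * G (0, 1, -1) + 6 * G (0, 1, 0) + 4 * G (1, -1, 1) +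
          6 * G (1, 0, 0) + 6 * G (1, 0, 1) + 4 * G (1, 1, 0)) := by
  obtain ⟨qk, qi, qj⟩ := q
  -- the parities of the eight cubes cornering at q
  have hbot : ∀ i j : ℤ, p1Par ((qk, qi, qj) - (0, i, j)) = decide (Even qk) := fun i j => by simp [p1Par]
  have htop : ∀ i j : ℤ, p1Par ((qk, qi, qj) - (1, i, j)) = !decide (Even qk) := fun i j => by
    by_cases hk : Even qk
    · have hk1 : ¬Even (qk - 1) := by rw [Int.even_sub_one]; exact not_not.2 hk
      simp [p1Par, hk, hk1]
    · have hk1 : Even (qk - 1) := by rw [Int.even_sub_one]; exact hk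
      simp [p1Par, hk, hk1]
  simp only [p1Corners, Finset.sum_insert, Finset.mem_insert, Finset.mem_singleton, Prod.mk.injEq, Finset.sum_singleton,
    zero_ne_one, one_ne_zero, and_false, and_true, or_self, not_false_eq_true, hbot, htop]
  rcases Int.even_or_odd qk with hk | hk
  · simp only [hk, decide_true, Bool.not_true, if_true]
    simp only [Fin.sum_univ_six, Fin.sum_univ_four, p1VertOff, Prod.mk.injEq, Prod.mk_sub_mk]
    norm_num
    ring
  · have hk0 : ¬Even qk := Int.not_even_iff_odd.2 hk
    simp only [hk0, decide_false, Bool.not_false, if_false]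
    simp only [Fin.sum_univ_six, Fin.sum_univ_four, p1VertOff, Prod.mk.injEq, Prod.mk_sub_mk]
    norm_num
    ring

/-- The hcp site differences summed over the star's edge multiset give `W(q) = ±(10a, −(10√3/3)a, 0)` (coordinate `k`). -/
theorem p1StarSum_hcpSite (a h : ℝ) (q : ℤ × ℤ × ℤ) (k : Fin 3) :
    (let G : ℤ × ℤ × ℤ → ℝ := fun d => hcpSite a h (q + d) k - hcpSite a h q k
     if Even q.1 then
        (4 * G (-1, -1, 0) + 6 * G (-1, 0, -1) + 6 * G (-1, 0, 0) + 4 * G (-1, 1, -1) + 6 * G (0, -1, 0) + 6 * G (0, -1, 1) +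
          4 * G (0, 0, -1) + 24 * G (0, 0, 0) + 4 * G (0, 0, 1) + 6 * G (0, 1, -1) + 6 * G (0, 1, 0) + 4 * G (1, -1, 0) +
          6 * G (1, 0, -1) + 6 * G (1, 0, 0) + 4 * G (1, 1, -1))
      else
        (4 * G (-1, -1, 1) + 6 * G (-1, 0, 0) + 6 * G (-1, 0, 1) + 4 * G (-1, 1, 0) + 6 * G (0, -1, 0) + 6 * G (0, -1, 1) +
          4 * G (0, 0, -1) + 24 * G (0, 0, 0) + 4 * G (0, 0, 1) + 6 * G (0, 1, -1) + 6 * G (0, 1, 0) + 4 * G (1, -1, 1) +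
          6 * G (1, 0, 0) + 6 * G (1, 0, 1) + 4 * G (1, 1, 0))) =
      (if Even q.1 then (![10 * a, -(10 * √3 / 3) * a, 0] : Fin 3 → ℝ) k else (![-(10 * a), 10 * √3 / 3 * a, 0] : Fin 3 → ℝ) k) := by
  obtain ⟨qk, qi, qj⟩ := q
  rcases Int.even_or_odd qk with hk | hk
  · have hk1 : ¬Even (qk + 1) := by rw [Int.even_add_one]; exact not_not.2 hk
    have hk2 : ¬Even (qk + -1) := by rw [← sub_eq_add_neg, Int.even_sub_one]; exact not_not.2 hk
    fin_cases k <;>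
      simp [hk, hk1, hk2, hcpSite_apply_zero, hcpSite_apply_one, hcpSite_apply_two, haggLabel_alternating] <;> ring
  · have hk0 : ¬Even qk := Int.not_even_iff_odd.2 hk
    have hk1 : Even (qk + 1) := by rw [Int.even_add_one]; exact hk0
    have hk2 : Even (qk + -1) := by rw [← sub_eq_add_neg, Int.even_sub_one]; exact hk0
    fin_cases k <;>
      simp [hk0, hk1, hk2, hcpSite_apply_zero, hcpSite_apply_one, hcpSite_apply_two, haggLabel_alternating] <;> ring

/-- **The lattice identity**: the sum over the 24 incidences of the star of `q` of the three edge vectors from `y_q`,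
`Σ_{o,π,m : p1VertOff (p1Par (q−o)) π m = o} Σ_{m'} (y_{(q−o)+v_{m'}} − y_q) = W(q)` (coordinate `k`). -/
theorem p1Star_edgeSum (a h : ℝ) (q : ℤ × ℤ × ℤ) (k : Fin 3) :
    (∑ o ∈ p1Corners, ∑ π : Fin 6, ∑ m : Fin 4,
        if p1VertOff (p1Par (q - o)) π m = o then
          ∑ m' : Fin 4, (hcpSite a h ((q - o) + p1VertOff (p1Par (q - o)) π m') k - hcpSite a h q k) else 0) =
      (if Even q.1 then (![10 * a, -(10 * √3 / 3) * a, 0] : Fin 3 → ℝ) k else (![-(10 * a), 10 * √3 / 3 * a, 0] : Fin 3 → ℝ) k) := by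
  rw [← p1StarSum_hcpSite a h q k]
  simp only []
  rw [← p1Star_sum_offsets q (fun d => hcpSite a h (q + d) k - hcpSite a h q k)]
  refine Finset.sum_congr rfl fun o _ => Finset.sum_congr rfl fun π _ => Finset.sum_congr rfl fun m _ => ?_
  split_ifs with ho
  · refine Finset.sum_congr rfl fun m' _ => ?_
    rw [show q - o + p1VertOff (p1Par (q - o)) π m' = q + (p1VertOff (p1Par (q - o)) π m' - o) by abel]
  · rfl

/-- **THE HAT FIRST MOMENT (star form)**: for every site `q` and coordinate `k`,
`Σ_{incidences (o,π,m) of the star of q} ∫_{cell (q−o,π)} λ_m(y)(y_k − (y_q)_k) dy = (√3a²h/240)·W(q)_k`,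
`W(q) = ±(10a, −(10√3/3)a, 0)` — i.e. `∫φ_q(y)(y − y_q)dy = V_site·m₁` with `V_site = √3a²h/2`, `m₁ = ±(a/12)(1, −1/√3, 0) ≠ 0`.
NOT a proof of H12⋆, NOT summit progress. -/
theorem p1Hat_firstMoment {a h : ℝ} (ha : 0 < a) (hh : 0 < h) (q : ℤ × ℤ × ℤ) (k : Fin 3) :
    (∑ o ∈ p1Corners, ∑ π : Fin 6, ∑ m : Fin 4,
        if p1VertOff (p1Par (q - o)) π m = o then
          ∫ y in p1RealCell a h (q - o, π), p1Lam a h (q - o, π) m y * (y k - hcpSite a h q k) else 0) =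
      √3 * a ^ 2 * h / 240 * (if Even q.1 then (![10 * a, -(10 * √3 / 3) * a, 0] : Fin 3 → ℝ) k else (![-(10 * a), 10 * √3 / 3 * a, 0] : Fin 3 → ℝ) k) := by
  rw [← p1Star_edgeSum a h q k, Finset.mul_sum]
  refine Finset.sum_congr rfl fun o _ => ?_
  rw [Finset.mul_sum]
  refine Finset.sum_congr rfl fun π _ => ?_
  rw [Finset.mul_sum]
  refine Finset.sum_congr rfl fun m _ => ?_
  split_ifs with ho
  · exact setIntegral_p1Lam_star_incidence ha hh q o π m k ho
  · simp

/-- **Non-centrosymmetry**: the first coordinate of the star first moment is `±(√3a²h/240)·10a ≠ 0`. -/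
theorem p1Hat_firstMoment_ne_zero {a h : ℝ} (ha : 0 < a) (hh : 0 < h) (q : ℤ × ℤ × ℤ) :
    (∑ o ∈ p1Corners, ∑ π : Fin 6, ∑ m : Fin 4,
        if p1VertOff (p1Par (q - o)) π m = o then
          ∫ y in p1RealCell a h (q - o, π), p1Lam a h (q - o, π) m y * (y 0 - hcpSite a h q 0) else 0) ≠ 0 := by
  rw [p1Hat_firstMoment ha hh q 0]
  have h3 : 0 < √3 := Real.sqrt_pos.2 (by norm_num)
  have hc : 0 < √3 * a ^ 2 * h / 240 := by positivity
  split_ifs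
  · simp only [Matrix.cons_val_zero]; exact mul_ne_zero hc.ne' (by positivity)
  · simp only [Matrix.cons_val_zero]; exact mul_ne_zero hc.ne' (neg_ne_zero.2 (by positivity))

end Summit.AtomisticToContinuum.Crystallization.Theorems.StrictSplittingRuleBirth

end
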